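import Mathlib.Algebra.Polynomial.Laurent
import Mathlib.Algebra.MonoidAlgebra.Support
import Literature.NumberTheory.Transcendental.ComplexForms
import HarnessLib

/-!
# The type decomposition of complex forms is direct (Voisin 2002, §2.3.1, eq. (2.4)) — proofs

Trunk **T-KAEHLER** (`NumberTheory/Transcendental`). Theorems-only companion file of
`Literature/NumberTheory/Transcendental/ComplexForms.lean`, discharging its eight hypothesis-free
(purely algebraic, fibrewise) named facts about the type projections `Literature.Geometry.Kaehler.MForm.typeComponent` /
`Literature.Geometry.Kaehler.MForm.weightComponent` and the predicate `Literature.NumberTheory.Transcendental.IsOfType`, and its two hypothesis-free facts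
about the exterior derivative `Literature.Geometry.Kaehler.mextDeriv` on complex forms (`d(cα) = c dα`, `dᾱ = \overline{dα}`):

| named fact of `ComplexForms.lean`            | discharged by                                   |
|----------------------------------------------|-------------------------------------------------|
| `Literature.NumberTheory.Transcendental.IsOfType.typeComponent_of_ne`           | `Literature.NumberTheory.Transcendental.IsOfType.typeComponent_of_ne_holds`        |
| `Literature.NumberTheory.Transcendental.isOfType_typeComponent`                 | `Literature.NumberTheory.Transcendental.isOfType_typeComponent_holds`              |
| `Literature.NumberTheory.Transcendental.isOfType_iff_typeComponent_eq_self`     | `Literature.NumberTheory.Transcendental.isOfType_iff_typeComponent_eq_self_holds`  |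
| `Literature.NumberTheory.Transcendental.typeComponent_typeComponent`            | `Literature.NumberTheory.Transcendental.typeComponent_typeComponent_holds`         |
| `Literature.NumberTheory.Transcendental.typeComponent_typeComponent_self`       | `Literature.NumberTheory.Transcendental.typeComponent_typeComponent_self_holds`    |
| `Literature.NumberTheory.Transcendental.sum_antidiagonal_typeComponent`         | `Literature.NumberTheory.Transcendental.sum_antidiagonal_typeComponent_holds`      |
| `Literature.NumberTheory.Transcendental.typeComponent_conj`                     | `Literature.NumberTheory.Transcendental.typeComponent_conj_holds`                  |
| `Literature.NumberTheory.Transcendental.IsOfType.wedge`                         | `Literature.NumberTheory.Transcendental.IsOfType.wedge_holds`                      |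
| `Literature.NumberTheory.Transcendental.mextDeriv_smul_complex`                 | `Literature.NumberTheory.Transcendental.mextDeriv_smul_complex_holds`              |
| `Literature.NumberTheory.Transcendental.mextDeriv_conj`                         | `Literature.NumberTheory.Transcendental.mextDeriv_conj_holds`                      |
| `Literature.NumberTheory.Transcendental.conj_mem_cclosedSmoothForms`            | `Literature.NumberTheory.Transcendental.conj_mem_cclosedSmoothForms_holds` (v2)    |
| `Literature.NumberTheory.Transcendental.conj_mem_cexactSmoothForms`             | `Literature.NumberTheory.Transcendental.conj_mem_cexactSmoothForms_holds` (v2)     |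

The first six say that, pointwise, a complex `k`-form decomposes uniquely into its components
of type `(p,q)`, `p + q = k`: `Λ^k Ω_{X,ℂ} = ⊕_{p+q=k} Ω_X^{p,q}` (Voisin (2002), §2.3.1,
eq. (2.4), p. 53; Wells (1980), Ch. I §3), for the concrete projections of `ComplexForms.lean`
(finite Fourier averages over the `(2k+1)`-st roots of unity); the last two are the Hodge
symmetry `\overline{Ω_X^{p,q}} = Ω_X^{q,p}` of the projections (Voisin (2002), Introduction,
display after eq. (0.2)) and the additivity of types under the wedge product
(`Ω_X^{p,q} = Λ^p Ω_X^{1,0} ⊗ Λ^q Ω_X^{0,1}`, loc. cit. §2.3.1). No smoothness and no atlas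
hypothesis is involved; everything is fibrewise linear algebra, plus (for the last two rows) the
fact that Mathlib's `fderivWithin` commutes with an invertible scalar and with post-composition
by a continuous linear equivalence at points of unique differentiability, junk values included.
(The remaining named facts of `ComplexForms.lean` concern smoothness of type components and the
`ℂ`-structure of the de Rham complex and are not touched here.)

## Proof

`ComplexForms.lean` defines the weight-`w` component of a `k`-form `β` by the finite average
`β_w(x)(v) = (2k+1)⁻¹ ∑_{j=0}^{2k} e^{-iwθ_j} β(x)(e^{iθ_j} v)`, `θ_j = 2πj/(2k+1)`, and
`β^{p,q} = β_{p-q}` for `p + q = k` (`0` otherwise); `β` has type `(p,q)` iff `p + q = k` and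
`β(x)(e^{iθ}v) = e^{i(p-q)θ} β(x)(v)` for all real `θ`.

1. *Character orthogonality* (`Literature.NumberTheory.Transcendental.sum_exp_mul_rootAngle_mul_I_eq_zero`): for `0 < |d| ≤ 2k`,
   `∑_{j=0}^{2k} e^{idθ_j} = 0` (geometric sum of a nontrivial `(2k+1)`-st root of unity).
2. *Forms of pure type* (§ `PureType`): if `β` has weight `w₀ = p - q`, substituting the
   transformation rule gives `β_w(x)(v) = (2k+1)⁻¹ (∑_j e^{i(w₀-w)θ_j}) β(x)(v)`, which is
   `β(x)(v)` for `w = w₀` (`Literature.NumberTheory.Transcendental.IsOfType.typeComponent_eq_self`) and `0` for `w ≠ w₀`,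
   `|w| ≤ k` (`Literature.NumberTheory.Transcendental.IsOfType.typeComponent_of_ne_holds`). This part uses only 1.
3. *Trigonometric polynomials* (§ `TrigPoly`): for an `ℝ`-multilinear `φ` in `n` vector
   variables of the complex vector space `E` and vectors `v_i`, the function
   `θ ↦ φ(e^{iθ}v_1, …, e^{iθ}v_n)` is a trigonometric polynomial `∑_m c_m e^{imθ}` whose
   frequencies `m` satisfy `|m| ≤ n`, `m ≡ n (mod 2)` (`Literature.NumberTheory.Transcendental.exists_fourier_multilinear`):
   induction on `n`, peeling off the first variable with `e^{iθ}v = cos θ · v + sin θ · (iv)` and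
   multilinearity, and writing `cos θ`, `sin θ` as Laurent polynomials in `e^{iθ}` with
   frequencies `±1`. Trigonometric polynomials are handled as Mathlib Laurent polynomials
   `ℂ[T;T⁻¹]` evaluated at the unit `e^{iθ}` (`LaurentPolynomial.eval₂`, a ring homomorphism;
   `Literature.NumberTheory.Transcendental.eval₂_expUnit_eq_sum`), the frequency set being the support.
4. *Fourier coefficients* (`Literature.Geometry.Kaehler.MForm.weightComponent_apply_of_fourier`): if
   `β(x)(e^{iθ}v) = ∑_m c_m e^{imθ}` with all `|m| ≤ k`, then for `|w| ≤ k` and all `θ`,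
   `β_w(x)(e^{iθ}v) = c_w e^{iwθ}` — expand, exchange the sums and apply 1 to each frequency
   `m ≠ w` (`|m - w| ≤ 2k`). Hence `β_w(x)(e^{iθ}v) = e^{iwθ} β_w(x)(v)`
   (`Literature.Geometry.Kaehler.MForm.weightComponent_apply_comp_tangentRotate`), i.e. `β^{p,q}` has type `(p,q)`
   (`Literature.NumberTheory.Transcendental.isOfType_typeComponent_holds`), and `∑_{p+q=k} β^{p,q}(x)(v) = ∑_{q ≤ k} c_{k-2q} =
   ∑_m c_m = β(x)(v)` since the frequencies are exactly the `k - 2q`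
   (`Literature.NumberTheory.Transcendental.sum_antidiagonal_typeComponent_holds`). Idempotence/orthogonality and the `iff`
   combine 2 and 4.
5. *Conjugation and wedge* (§ `ConjWedge`, independent of 1–4): conjugation commutes with the
   finite Fourier average up to `w ↦ -w` (`Literature.Geometry.Kaehler.MForm.conj_weightComponent_neg`), whence
   `(ᾱ)^{p,q} = \overline{α^{q,p}}`; and if a linear map `R` acts on `a`, `b` by the scalars
   `c_a`, `c_b` then it acts on `a ∧ b` by `c_a c_b` (shuffle formula,
   `Literature.NumberTheory.Transcendental.ContinuousAlternatingMap.wedge_apply_comp_eq_mul`), whence types add under `∧`.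
6. *Exterior derivative* (§ `Derivative`, independent of 1–5): `Literature.Geometry.Kaehler.mextDeriv` is
   `extDerivWithin` of the chart representative, i.e. `alternatizeUncurryFin ∘ fderivWithin`;
   `fderivWithin (c • φ) = c • fderivWithin φ` for a complex scalar `c`
   (`fderivWithin_const_smul_field`, no differentiability needed) and
   `fderivWithin (ι ∘ φ) = ι ∘ fderivWithin φ` for the real-linear automorphism `ι` =
   post-composition with complex conjugation (`ContinuousLinearEquiv.comp_fderivWithin`), and
   `alternatizeUncurryFin` is natural in the codomain.

## References

* C. Voisin, *Hodge Theory and Complex Algebraic Geometry I*, Cambridge Studies in Advanced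
  Mathematics 76, Cambridge University Press (2002), §2.3.1 "Definition", eq. (2.4), p. 53 (the
  type decomposition `Λ^k Ω_{X,ℂ} = ⊕_{p+q=k} Ω_X^{p,q}`,
  `Ω_X^{p,q} = Λ^p Ω_X^{1,0} ⊗ Λ^q Ω_X^{0,1}`); Introduction, eq. (0.2) and the Hodge symmetry
  `\overline{Ω_X^{p,q}} = Ω_X^{q,p}` displayed after it. [cite: Voisin2002]
* R. O. Wells, *Differential Analysis on Complex Manifolds* (1980), Ch. I §3 (the projections
  onto `Λ^{p,q}`).
-/

noncomputable section

open scoped Manifold ContDiff Topology LaurentPolynomial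
open Bundle Set Finset

namespace Literature.NumberTheory.Transcendental

/-! ### Character orthogonality for `ℤ/(2k+1)` -/

section Characters

variable {k : ℕ}

/-- **Orthogonality of the characters of `ℤ/(2k+1)`**: for an integer `d` with `0 < |d| ≤ 2k`,
`∑_{j=0}^{2k} e^{i d θ_j} = 0` where `θ_j = 2πj/(2k+1)`. Indeed `ζ = e^{2πid/(2k+1)}` satisfies
`ζ^{2k+1} = 1` and `ζ ≠ 1` (as `(2k+1) ∤ d`), and `(∑_{j<2k+1} ζ^j)(ζ - 1) = ζ^{2k+1} - 1 = 0`
(`geom_sum_mul`). The angles are written exactly as in `Literature.Geometry.Kaehler.MForm.weightComponent`. [folklore] -/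
theorem sum_exp_mul_rootAngle_mul_I_eq_zero {d : ℤ} (hd : d ≠ 0) (hdk : d.natAbs ≤ 2 * k) :
    ∑ j : Fin (2 * k + 1),
      Complex.exp ((d : ℂ) * ((2 * Real.pi * j / (2 * k + 1) : ℝ) : ℂ) * Complex.I) = 0 := by
  set ζ : ℂ := Complex.exp ((d : ℂ) * (2 * Real.pi / (2 * k + 1)) * Complex.I) with hζ
  have hN : (2 * (k : ℂ) + 1) ≠ 0 := by exact_mod_cast (Nat.succ_ne_zero (2 * k))
  have hterm : ∀ j : ℕ,
      Complex.exp ((d : ℂ) * ((2 * Real.pi * j / (2 * k + 1) : ℝ) : ℂ) * Complex.I) = ζ ^ j := by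
    intro j
    rw [hζ, ← Complex.exp_nat_mul]
    congr 1
    push_cast
    ring
  have hζn : ζ ^ (2 * k + 1) = 1 := by
    rw [hζ, ← Complex.exp_nat_mul]
    have : ((2 * k + 1 : ℕ) : ℂ) * ((d : ℂ) * (2 * Real.pi / (2 * k + 1)) * Complex.I) =
        d * (2 * Real.pi * Complex.I) := by
      push_cast
      field_simp
    rw [this]
    exact Complex.exp_int_mul_two_pi_mul_I d
  have hζ1 : ζ ≠ 1 := by
    intro h
    rw [hζ, Complex.exp_eq_one_iff] at h
    obtain ⟨m, hm⟩ := h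
    have h2 : (d : ℂ) = m * (2 * k + 1) := by
      field_simp at hm
      linear_combination hm
    have h3 : d = m * (2 * k + 1) := by exact_mod_cast h2
    have hm0 : m ≠ 0 := by
      rintro rfl
      exact hd (by simpa using h3)
    have : 2 * k + 1 ≤ d.natAbs := by
      rw [h3, Int.natAbs_mul]
      have h4 : ((2 * k + 1 : ℤ)).natAbs = 2 * k + 1 := by
        exact_mod_cast Int.natAbs_natCast (2 * k + 1)
      rw [h4]
      exact Nat.le_mul_of_pos_left _ (Int.natAbs_pos.mpr hm0)
    omega
  calc ∑ j : Fin (2 * k + 1),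
        Complex.exp ((d : ℂ) * ((2 * Real.pi * j / (2 * k + 1) : ℝ) : ℂ) * Complex.I)
      = ∑ j ∈ Finset.range (2 * k + 1), ζ ^ j := by
        rw [← Fin.sum_univ_eq_sum_range]
        exact Finset.sum_congr rfl fun j _ ↦ hterm j
    _ = 0 := by
        have h := geom_sum_mul ζ (2 * k + 1)
        rw [hζn, sub_self] at h
        exact (mul_eq_zero.mp h).resolve_right (sub_ne_zero.mpr hζ1)

end Characters

variable {E : Type*} [NormedAddCommGroup E] [NormedSpace ℂ E]
  {M : Type*} [TopologicalSpace M] [ChartedSpace E M] {k : ℕ}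

/-! ### Forms of pure type: the cheap half -/

section PureType

variable {p q : ℕ} {α : Literature.Geometry.Kaehler.MForm 𝓘(ℝ, E) M ℂ k}

/-- The defining transformation rule of a form of type `(p,q)` under the rotations `e^{iθ}`,
`α(x)(e^{iθ}v) = e^{i(p-q)θ} α(x)(v)`, with the rotated vectors written as a composition (the
form in which `ContinuousAlternatingMap.compContinuousLinearMap_apply` produces them).
Voisin (2002), §2.3.1. [cite: Voisin2002, §2.3.1] -/
theorem IsOfType.apply_comp_tangentRotate (hα : IsOfType p q α) (x : M) (θ : ℝ)
    (v : Fin k → TangentSpace 𝓘(ℝ, E) x) :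
    α x (⇑(tangentRotate E x θ) ∘ v) = Complex.exp (((p : ℤ) - q : ℤ) * θ * Complex.I) * α x v :=
  hα.2 x θ v

/-- **Weight components of a form of pure type.** If `α` has type `(p,q)` (weight `p - q`), then
its weight-`w` average is the explicit multiple
`α_w(x)(v) = (2k+1)⁻¹ (∑_{j=0}^{2k} e^{i(p-q-w)θ_j}) α(x)(v)`, `θ_j = 2πj/(2k+1)`, of `α(x)(v)`
(substitute the transformation rule into the finite Fourier average defining
`Literature.Geometry.Kaehler.MForm.weightComponent`). [folklore] -/
theorem IsOfType.weightComponent_apply (hα : IsOfType p q α) (w : ℤ) (x : M)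
    (v : Fin k → TangentSpace 𝓘(ℝ, E) x) :
    α.weightComponent w x v =
      ((2 * k + 1 : ℕ) : ℂ)⁻¹ * (∑ j : Fin (2 * k + 1),
        Complex.exp ((((p : ℤ) - q - w : ℤ) : ℂ) * ((2 * Real.pi * j / (2 * k + 1) : ℝ) : ℂ) *
          Complex.I)) * α x v := by
  simp only [Literature.Geometry.Kaehler.MForm.weightComponent, ContinuousAlternatingMap.smul_apply,
    ContinuousAlternatingMap.sum_apply, ContinuousAlternatingMap.compContinuousLinearMap_apply,
    hα.apply_comp_tangentRotate, smul_eq_mul, Finset.sum_mul, mul_assoc]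
  congr 1
  refine Finset.sum_congr rfl fun j _ ↦ ?_
  rw [← mul_assoc, ← Complex.exp_add]
  congr 1
  push_cast
  ring

/-- **A form of pure type `(p,q)` equals its `(p,q)`-component**, `α^{p,q} = α` — the forward
implication of the named fact `Literature.NumberTheory.Transcendental.isOfType_iff_typeComponent_eq_self`, i.e. the projection of
`Λ^k Ω_{X,ℂ} = ⊕_{p+q=k} Ω_X^{p,q}` onto `Ω_X^{p,q}` is the identity on `Ω_X^{p,q}`. Proof: in
`IsOfType.weightComponent_apply` with `w = p - q` every summand is `e^0 = 1`, so the average of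
the `2k+1` terms is `α(x)(v)`. Voisin (2002), §2.3.1, eq. (2.4), p. 53. [cite: Voisin2002, §2.3.1 eq. (2.4)] -/
theorem IsOfType.typeComponent_eq_self (hα : IsOfType p q α) : α.typeComponent p q = α := by
  rw [Literature.Geometry.Kaehler.MForm.typeComponent, if_pos hα.1]
  funext x; ext v
  rw [hα.weightComponent_apply]
  simp only [sub_self, Int.cast_zero, zero_mul, Complex.exp_zero, Finset.sum_const,
    Finset.card_univ, Fintype.card_fin, nsmul_eq_mul, mul_one]
  rw [inv_mul_cancel₀ (by exact_mod_cast Nat.succ_ne_zero (2 * k)), one_mul]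

end PureType

/-- Discharge of the named fact `Literature.NumberTheory.Transcendental.IsOfType.typeComponent_of_ne`: **the other type components
of a form of pure type `(p,q)` vanish**, `α^{p',q'} = 0` for `(p',q') ≠ (p,q)` — the
directness of the type decomposition `Λ^k Ω_{X,ℂ} = ⊕_{p+q=k} Ω_X^{p,q}` (Voisin (2002), §2.3.1,
eq. (2.4), p. 53) for the projections of `ComplexForms.lean`. Proof: for `p' + q' ≠ k` the
component is `0` by definition (`MForm.typeComponent_of_ne`); for `p' + q' = k = p + q` the
weights differ, `d = (p - q) - (p' - q') ≠ 0` with `|d| ≤ 2k`, and by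
`IsOfType.weightComponent_apply` the component is `(2k+1)⁻¹ (∑_j e^{idθ_j}) α = 0` by the
character orthogonality `sum_exp_mul_rootAngle_mul_I_eq_zero`. [cite: Voisin2002, §2.3.1 eq. (2.4)] -/
theorem IsOfType.typeComponent_of_ne_holds :
    IsOfType.typeComponent_of_ne (E := E) (M := M) (k := k) := by
  intro p q p' q' α hα hne
  by_cases h' : p' + q' = k
  · rw [Literature.Geometry.Kaehler.MForm.typeComponent, if_pos h']
    funext x; ext v
    have hk := hα.1
    rw [hα.weightComponent_apply, sum_exp_mul_rootAngle_mul_I_eq_zero, mul_zero, zero_mul]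
    · rfl
    · omega
    · omega
  · exact Literature.Geometry.Kaehler.MForm.typeComponent_of_ne h' α

/-! ### Trigonometric polynomials as Laurent polynomials evaluated at `e^{iθ}` -/

section TrigPoly

/-- Local notation (this file only): the unit `e^{iθ} ∈ ℂˣ` at which complex Laurent polynomials
`P = ∑_m c_m T^m ∈ ℂ[T;T⁻¹]` are evaluated; `LaurentPolynomial.eval₂ (RingHom.id ℂ) 𝕖(θ) P` is
then the trigonometric polynomial `∑_m c_m e^{imθ}` (`eval₂_expUnit_eq_sum`). -/
local notation "𝕖(" θ ")" =>
  Units.mk0 (Complex.exp (Complex.ofReal θ * Complex.I)) (Complex.exp_ne_zero _)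

/-- `(e^{iθ})^m = e^{imθ}` for `m ∈ ℤ`. [folklore] -/
theorem val_expUnit_zpow (θ : ℝ) (m : ℤ) :
    ((𝕖(θ) ^ m : ℂˣ) : ℂ) = Complex.exp (m * θ * Complex.I) := by
  rw [Units.val_zpow_eq_zpow_val, Units.val_mk0, ← Complex.exp_int_mul, mul_assoc]

/-- A monomial `a T^m` evaluates at `e^{iθ}` to `a e^{imθ}`. [folklore] -/
theorem eval₂_expUnit_single (m : ℤ) (a : ℂ) (θ : ℝ) :
    LaurentPolynomial.eval₂ (RingHom.id ℂ) 𝕖(θ) (AddMonoidAlgebra.single m a) =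
      a * Complex.exp (m * θ * Complex.I) := by
  rw [LaurentPolynomial.single_eq_C_mul_T, LaurentPolynomial.eval₂_C_mul_T, val_expUnit_zpow,
    RingHom.id_apply]

/-- **Evaluation at `e^{iθ}` is the Fourier sum over the frequencies**:
`P(e^{iθ}) = ∑_{m ∈ supp P} c_m e^{imθ}`. [folklore] -/
theorem eval₂_expUnit_eq_sum (P : LaurentPolynomial ℂ) (θ : ℝ) :
    LaurentPolynomial.eval₂ (RingHom.id ℂ) 𝕖(θ) P =
      ∑ m ∈ P.coeff.support, P.coeff m * Complex.exp (m * θ * Complex.I) := by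
  conv_lhs => rw [← AddMonoidAlgebra.sum_coeff_single P]
  rw [Finsupp.sum, map_sum]
  exact Finset.sum_congr rfl fun m _ ↦ eval₂_expUnit_single m _ θ

/-- **Euler**: `cos θ = (e^{iθ} + e^{-iθ})/2`, as the value at `e^{iθ}` of the Laurent polynomial
`½T + ½T⁻¹` (Mathlib's definition of `Complex.cos`). [folklore] -/
theorem cos_eq_eval₂_expUnit (θ : ℝ) :
    (Real.cos θ : ℂ) = LaurentPolynomial.eval₂ (RingHom.id ℂ) 𝕖(θ)
      (AddMonoidAlgebra.single 1 (1 / 2) + AddMonoidAlgebra.single (-1) (1 / 2)) := by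
  rw [map_add, eval₂_expUnit_single, eval₂_expUnit_single, Complex.ofReal_cos, Complex.cos]
  push_cast
  ring_nf

/-- **Euler**: `sin θ = (e^{-iθ} - e^{iθ})·i/2`, as the value at `e^{iθ}` of the Laurent
polynomial `(i/2)T⁻¹ - (i/2)T` (Mathlib's definition of `Complex.sin`). [folklore] -/
theorem sin_eq_eval₂_expUnit (θ : ℝ) :
    (Real.sin θ : ℂ) = LaurentPolynomial.eval₂ (RingHom.id ℂ) 𝕖(θ)
      (AddMonoidAlgebra.single (-1) (Complex.I / 2) +
        AddMonoidAlgebra.single 1 (-(Complex.I / 2))) := by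
  rw [map_add, eval₂_expUnit_single, eval₂_expUnit_single, Complex.ofReal_sin, Complex.sin]
  push_cast
  ring_nf

/-- The frequencies of a two-term Laurent polynomial `a T + b T⁻¹` are `±1`. [folklore] -/
theorem support_single_one_add_single_neg_one_subset (a b : ℂ) (ε : ℤ) (hε : ε = 1 ∨ ε = -1) :
    (AddMonoidAlgebra.single ε a + AddMonoidAlgebra.single (-ε) b :
        LaurentPolynomial ℂ).coeff.support ⊆ {1, -1} := by
  rw [AddMonoidAlgebra.coeff_add]
  refine Finsupp.support_add.trans (Finset.union_subset ?_ ?_)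
  · exact Finsupp.support_single_subset.trans (by rcases hε with rfl | rfl <;> simp)
  · exact Finsupp.support_single_subset.trans (by rcases hε with rfl | rfl <;> simp)

omit [NormedAddCommGroup E] [NormedSpace ℂ E] in
/-- **Euler's formula on vectors**: `e^{iθ} • u = cos θ • u + sin θ • (i u)` in a complex vector
space, with real scalars on the right (the real structure restricted from `ℂ`). [folklore] -/
theorem exp_mul_I_smul_eq {E : Type*} [AddCommGroup E] [Module ℂ E] (θ : ℝ) (u : E) :
    Complex.exp (θ * Complex.I) • u = (Real.cos θ) • u + (Real.sin θ) • (Complex.I • u) := by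
  rw [Complex.exp_mul_I, ← Complex.ofReal_cos, ← Complex.ofReal_sin, add_smul, mul_smul,
    Complex.coe_smul, Complex.coe_smul]

/-- The admissible frequencies `m` for `k` vector variables — `|m| ≤ k`, `m ≡ k (mod 2)` — are
exactly the differences `p - q` with `p + q = k`. [folklore] -/
theorem exists_antidiagonal_sub_eq_of_natAbs_le {m : ℤ} (hm : m.natAbs ≤ k ∧ (2 : ℤ) ∣ m + k) :
    ∃ pq ∈ antidiagonal k, (pq.1 : ℤ) - pq.2 = m := by
  refine ⟨(((m + k) / 2).toNat, k - ((m + k) / 2).toNat), ?_, ?_⟩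
  · rw [Finset.mem_antidiagonal]
    omega
  · push_cast
    omega

/-- **Multilinear maps along a rotating frame are trigonometric polynomials.** For an
`ℝ`-multilinear map `φ` in `n` variables on a complex vector space `E` with values in `ℂ` and
vectors `v_1, …, v_n`, the function `θ ↦ φ(e^{iθ}v_1, …, e^{iθ}v_n)` is a Fourier sum
`∑_m c_m e^{imθ}` with frequencies `|m| ≤ n`, `m ≡ n (mod 2)` (the coefficients packaged as a
Laurent polynomial `P = ∑_m c_m T^m`, the frequency set being its support). Proof by induction
on `n`: peel off the first variable, `e^{iθ}v_1 = cos θ · v_1 + sin θ · (iv_1)`, use linearity in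
it (`MultilinearMap.cons_add/cons_smul`, the remaining variables forming `φ.curryLeft _`), the
induction hypothesis for the two curried maps, and `cos θ`, `sin θ` as Laurent polynomials in
`e^{iθ}` with frequencies `±1`, evaluation at `e^{iθ}` being a ring homomorphism
(`LaurentPolynomial.eval₂`) and frequencies of a product adding up
(`AddMonoidAlgebra.support_coeff_mul_subset`). This is the finite-dimensionality statement
behind the `U(1)`-weight decomposition of `Λ^n (E_ℝ)^* ⊗ ℂ` (Voisin (2002), §2.3.1; Wells (1980),
Ch. I §3). [folklore] -/
theorem exists_fourier_multilinear :
    ∀ (n : ℕ) (φ : MultilinearMap ℝ (fun _ : Fin n ↦ E) ℂ) (v : Fin n → E),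
      ∃ P : LaurentPolynomial ℂ, (∀ m ∈ P.coeff.support, m.natAbs ≤ n ∧ (2 : ℤ) ∣ m + n) ∧
        ∀ θ : ℝ, φ (fun i ↦ Complex.exp (θ * Complex.I) • v i) =
          ∑ m ∈ P.coeff.support, P.coeff m * Complex.exp (m * θ * Complex.I)
  | 0, φ, v => by
      refine ⟨LaurentPolynomial.C (φ v), fun m hm ↦ ?_, fun θ ↦ ?_⟩
      · have : m ∈ ({0} : Finset ℤ) := Finsupp.support_single_subset hm
        rw [Finset.mem_singleton] at this
        subst this
        exact ⟨by simp, by simp⟩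
      · rw [← eval₂_expUnit_eq_sum, LaurentPolynomial.eval₂_C, RingHom.id_apply]
        exact congrArg φ (funext fun i ↦ Fin.elim0 i)
  | n + 1, φ, v => by
      obtain ⟨P₁, hP₁, h₁⟩ := exists_fourier_multilinear n (φ.curryLeft (v 0)) (Fin.tail v)
      obtain ⟨P₂, hP₂, h₂⟩ :=
        exists_fourier_multilinear n (φ.curryLeft (Complex.I • v 0)) (Fin.tail v)
      refine ⟨(AddMonoidAlgebra.single 1 (1 / 2) + AddMonoidAlgebra.single (-1) (1 / 2)) * P₁ +
          (AddMonoidAlgebra.single (-1) (Complex.I / 2) +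
            AddMonoidAlgebra.single 1 (-(Complex.I / 2))) * P₂,
        fun m hm ↦ ?_, fun θ ↦ ?_⟩
      · classical
        rw [AddMonoidAlgebra.coeff_add] at hm
        have key : ∀ {Q P : LaurentPolynomial ℂ}, Q.coeff.support ⊆ {1, -1} →
            (∀ m ∈ P.coeff.support, m.natAbs ≤ n ∧ (2 : ℤ) ∣ m + n) →
            m ∈ (Q * P).coeff.support → m.natAbs ≤ n + 1 ∧ (2 : ℤ) ∣ m + (n + 1 : ℕ) := by
          intro Q P hQ hP hm
          have h := AddMonoidAlgebra.support_coeff_mul_subset Q P hm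
          obtain ⟨a, ha, b, hb, rfl⟩ := Finset.mem_add.mp h
          have ha' := hQ ha
          have hb' := hP b hb
          simp only [Finset.mem_insert, Finset.mem_singleton] at ha'
          rcases ha' with rfl | rfl <;> omega
        rcases Finset.mem_union.mp (Finsupp.support_add hm) with hm | hm
        · exact key (support_single_one_add_single_neg_one_subset _ _ 1 (Or.inl rfl)) hP₁ hm
        · exact key (support_single_one_add_single_neg_one_subset _ _ (-1) (Or.inr rfl)) hP₂ hm
      · have hv : (fun i : Fin (n + 1) ↦ Complex.exp (θ * Complex.I) • v i) =
            Fin.cons ((Real.cos θ) • v 0 + (Real.sin θ) • (Complex.I • v 0))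
              (fun i : Fin n ↦ Complex.exp (θ * Complex.I) • Fin.tail v i) := by
          funext i
          refine Fin.cases ?_ (fun j ↦ ?_) i
          · rw [Fin.cons_zero, exp_mul_I_smul_eq]
          · rw [Fin.cons_succ]
            rfl
        rw [hv, φ.cons_add, φ.cons_smul, φ.cons_smul, ← MultilinearMap.curryLeft_apply,
          ← MultilinearMap.curryLeft_apply, h₁ θ, h₂ θ, ← eval₂_expUnit_eq_sum,
          ← eval₂_expUnit_eq_sum, ← eval₂_expUnit_eq_sum, map_add, map_mul, map_mul,
          ← cos_eq_eval₂_expUnit, ← sin_eq_eval₂_expUnit, Complex.real_smul, Complex.real_smul]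

end TrigPoly

/-! ### Weight components of an arbitrary form -/

section Weights

/-- Rotations compose by adding angles: `e^{iθ₁}(e^{iθ₂}v) = e^{i(θ₁+θ₂)}v`. [folklore] -/
theorem tangentRotate_comp_tangentRotate (x : M) (θ₁ θ₂ : ℝ)
    (v : Fin k → TangentSpace 𝓘(ℝ, E) x) :
    (⇑(tangentRotate E x θ₁) ∘ (⇑(tangentRotate E x θ₂) ∘ v)) =
      ⇑(tangentRotate E x (θ₁ + θ₂)) ∘ v := by
  funext i
  simp only [Function.comp_apply, tangentRotate_apply]
  rw [← mul_smul, ← Complex.exp_add]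
  congr 1
  push_cast
  ring

/-- Rotation by `0` is the identity (on tuples of vectors). [folklore] -/
theorem tangentRotate_zero_comp (x : M) (v : Fin k → TangentSpace 𝓘(ℝ, E) x) :
    (⇑(tangentRotate E x 0) ∘ v) = v := by
  funext i
  exact tangentRotate_zero_apply x (v i)

/-- **A `k`-form along a rotating frame is a trigonometric polynomial of degree `≤ k`**:
`θ ↦ β(x)(e^{iθ}v_1, …, e^{iθ}v_k) = ∑_m c_m e^{imθ}` with `|m| ≤ k`, `m ≡ k (mod 2)`
(`exists_fourier_multilinear` for the `ℝ`-multilinear map `β(x)`). Voisin (2002), §2.3.1;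
Wells (1980), Ch. I §3. [folklore] -/
theorem _root_.Literature.Geometry.Kaehler.MForm.exists_fourier (β : Literature.Geometry.Kaehler.MForm 𝓘(ℝ, E) M ℂ k) (x : M)
    (v : Fin k → TangentSpace 𝓘(ℝ, E) x) :
    ∃ P : LaurentPolynomial ℂ, (∀ m ∈ P.coeff.support, m.natAbs ≤ k ∧ (2 : ℤ) ∣ m + k) ∧
      ∀ θ : ℝ, β x (⇑(tangentRotate E x θ) ∘ v) =
        ∑ m ∈ P.coeff.support, P.coeff m * Complex.exp (m * θ * Complex.I) :=
  exists_fourier_multilinear k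
    (show MultilinearMap ℝ (fun _ : Fin k ↦ E) ℂ from (β x).toMultilinearMap) (show Fin k → E from v)

/-- **Weight components are Fourier coefficients.** If `β(x)(e^{iθ}v) = ∑_m c_m e^{imθ}` with all
frequencies `|m| ≤ k`, then for `|w| ≤ k` and every `θ`,
`β_w(x)(e^{iθ}v) = c_w e^{iwθ}`: expanding the finite Fourier average,
`β_w(x)(e^{iθ}v) = (2k+1)⁻¹ ∑_j e^{-iwθ_j} ∑_m c_m e^{im(θ_j+θ)} =
∑_m c_m e^{imθ} (2k+1)⁻¹ ∑_j e^{i(m-w)θ_j}`, and the inner sum is `2k+1` for `m = w` and `0`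
otherwise (`sum_exp_mul_rootAngle_mul_I_eq_zero`, as `0 < |m - w| ≤ 2k`). [folklore] -/
theorem _root_.Literature.Geometry.Kaehler.MForm.weightComponent_apply_of_fourier (β : Literature.Geometry.Kaehler.MForm 𝓘(ℝ, E) M ℂ k) (x : M)
    (v : Fin k → TangentSpace 𝓘(ℝ, E) x) {P : LaurentPolynomial ℂ}
    (hP : ∀ m ∈ P.coeff.support, m.natAbs ≤ k ∧ (2 : ℤ) ∣ m + k)
    (hPev : ∀ θ : ℝ, β x (⇑(tangentRotate E x θ) ∘ v) =
      ∑ m ∈ P.coeff.support, P.coeff m * Complex.exp (m * θ * Complex.I))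
    {w : ℤ} (hw : w.natAbs ≤ k) (θ : ℝ) :
    β.weightComponent w x (⇑(tangentRotate E x θ) ∘ v) =
      P.coeff w * Complex.exp (w * θ * Complex.I) := by
  have hC : ((2 * k + 1 : ℕ) : ℂ) ≠ 0 := by exact_mod_cast Nat.succ_ne_zero (2 * k)
  simp only [Literature.Geometry.Kaehler.MForm.weightComponent, ContinuousAlternatingMap.smul_apply,
    ContinuousAlternatingMap.sum_apply, ContinuousAlternatingMap.compContinuousLinearMap_apply,
    tangentRotate_comp_tangentRotate, hPev, smul_eq_mul]
  rw [inv_mul_eq_iff_eq_mul₀ hC]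
  simp only [Finset.mul_sum]
  rw [Finset.sum_comm]
  have inner : ∀ m ∈ P.coeff.support,
      ∑ j : Fin (2 * k + 1),
        Complex.exp (-(((w * (2 * Real.pi * j / (2 * k + 1)) : ℝ) : ℂ)) * Complex.I) *
          (P.coeff m *
            Complex.exp (m * ((2 * Real.pi * j / (2 * k + 1) + θ : ℝ) : ℂ) * Complex.I)) =
        if m = w then ((2 * k + 1 : ℕ) : ℂ) * (P.coeff w * Complex.exp (w * θ * Complex.I))
        else 0 := by
    intro m hm
    have hterm : ∀ j : Fin (2 * k + 1),
        Complex.exp (-(((w * (2 * Real.pi * j / (2 * k + 1)) : ℝ) : ℂ)) * Complex.I) *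
          (P.coeff m *
            Complex.exp (m * ((2 * Real.pi * j / (2 * k + 1) + θ : ℝ) : ℂ) * Complex.I)) =
        P.coeff m * Complex.exp (m * θ * Complex.I) *
          Complex.exp (((m - w : ℤ) : ℂ) * ((2 * Real.pi * j / (2 * k + 1) : ℝ) : ℂ) *
            Complex.I) := by
      intro j
      have hexp : Complex.exp (-(((w * (2 * Real.pi * j / (2 * k + 1)) : ℝ) : ℂ)) * Complex.I) *
          Complex.exp (m * ((2 * Real.pi * j / (2 * k + 1) + θ : ℝ) : ℂ) * Complex.I) =
          Complex.exp (m * θ * Complex.I) *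
            Complex.exp (((m - w : ℤ) : ℂ) * ((2 * Real.pi * j / (2 * k + 1) : ℝ) : ℂ) *
              Complex.I) := by
        rw [← Complex.exp_add, ← Complex.exp_add]
        congr 1
        push_cast
        ring
      linear_combination P.coeff m * hexp
    simp only [hterm, ← Finset.mul_sum]
    split_ifs with hmw
    · subst hmw
      simp only [sub_self, Int.cast_zero, zero_mul, Complex.exp_zero, Finset.sum_const,
        Finset.card_univ, Fintype.card_fin, nsmul_eq_mul, mul_one]
      ring
    · have hmk := hP m hm
      rw [sum_exp_mul_rootAngle_mul_I_eq_zero (by omega) (by omega), mul_zero]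
  rw [Finset.sum_congr rfl inner, Finset.sum_ite_eq']
  split_ifs with hw'
  · rfl
  · rw [Finsupp.notMem_support_iff.mp hw', zero_mul, mul_zero]

/-- **Weight components are Fourier coefficients** (value form): with `P` as in
`MForm.weightComponent_apply_of_fourier`, `β_w(x)(v) = c_w` for `|w| ≤ k` (take `θ = 0`). [folklore] -/
theorem _root_.Literature.Geometry.Kaehler.MForm.weightComponent_apply_eq_coeff (β : Literature.Geometry.Kaehler.MForm 𝓘(ℝ, E) M ℂ k) (x : M)
    (v : Fin k → TangentSpace 𝓘(ℝ, E) x) {P : LaurentPolynomial ℂ}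
    (hP : ∀ m ∈ P.coeff.support, m.natAbs ≤ k ∧ (2 : ℤ) ∣ m + k)
    (hPev : ∀ θ : ℝ, β x (⇑(tangentRotate E x θ) ∘ v) =
      ∑ m ∈ P.coeff.support, P.coeff m * Complex.exp (m * θ * Complex.I))
    {w : ℤ} (hw : w.natAbs ≤ k) :
    β.weightComponent w x v = P.coeff w := by
  have h0 := β.weightComponent_apply_of_fourier x v hP hPev hw 0
  rw [tangentRotate_zero_comp] at h0
  rw [h0]
  push_cast
  simp only [mul_zero, zero_mul, Complex.exp_zero, mul_one]

/-- **The weight-`w` component has weight `w`**: for every complex `k`-form `β` (no hypothesis)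
and `|w| ≤ k`, `β_w(x)(e^{iθ}v) = e^{iwθ} β_w(x)(v)` for all real `θ` — the finite Fourier
average over the `(2k+1)`-st roots of unity is the projection onto the `U(1)`-weight space,
because `θ ↦ β(x)(e^{iθ}v)` has frequencies in `[-k, k]` only (`MForm.exists_fourier`,
`MForm.weightComponent_apply_of_fourier`). Voisin (2002), §2.3.1; Wells (1980), Ch. I §3. [folklore] -/
theorem _root_.Literature.Geometry.Kaehler.MForm.weightComponent_apply_comp_tangentRotate (β : Literature.Geometry.Kaehler.MForm 𝓘(ℝ, E) M ℂ k) {w : ℤ}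
    (hw : w.natAbs ≤ k) (x : M) (θ : ℝ) (v : Fin k → TangentSpace 𝓘(ℝ, E) x) :
    β.weightComponent w x (⇑(tangentRotate E x θ) ∘ v) =
      Complex.exp (w * θ * Complex.I) * β.weightComponent w x v := by
  obtain ⟨P, hP, hPev⟩ := β.exists_fourier x v
  rw [β.weightComponent_apply_of_fourier x v hP hPev hw θ,
    β.weightComponent_apply_eq_coeff x v hP hPev hw, mul_comm]

end Weights

/-! ### The remaining discharges -/

/-- Discharge of the named fact `Literature.NumberTheory.Transcendental.isOfType_typeComponent`: **the `(p,q)`-component of a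
`(p+q)`-form has type `(p,q)`** (`MForm.weightComponent_apply_comp_tangentRotate` with
`w = p - q`, `|p - q| ≤ p + q = k`). Voisin (2002), §2.3.1, eq. (2.4), p. 53 (the projection onto
the summand `Ω_X^{p,q}`). [cite: Voisin2002, §2.3.1 eq. (2.4)] -/
theorem isOfType_typeComponent_holds : isOfType_typeComponent (E := E) (M := M) (k := k) := by
  intro p q h α
  refine ⟨h, fun x θ v ↦ ?_⟩
  rw [Literature.Geometry.Kaehler.MForm.typeComponent, if_pos h]
  exact α.weightComponent_apply_comp_tangentRotate (w := (p : ℤ) - q) (by omega) x θ v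

/-- Discharge of the named fact `Literature.NumberTheory.Transcendental.isOfType_iff_typeComponent_eq_self`: **a `(p+q)`-form has
type `(p,q)` iff it equals its `(p,q)`-component** (`IsOfType.typeComponent_eq_self` and
`isOfType_typeComponent_holds`). Voisin (2002), §2.3.1, eq. (2.4), p. 53. [cite: Voisin2002, §2.3.1 eq. (2.4)] -/
theorem isOfType_iff_typeComponent_eq_self_holds :
    isOfType_iff_typeComponent_eq_self (E := E) (M := M) (k := k) := by
  intro p q h α
  refine ⟨fun hα ↦ hα.typeComponent_eq_self, fun hα ↦ ?_⟩
  rw [← hα]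
  exact isOfType_typeComponent_holds h α

/-- Discharge of the named fact `Literature.NumberTheory.Transcendental.typeComponent_typeComponent`: **idempotence and
orthogonality of the type projections**, `(α^{p,q})^{p',q'} = α^{p,q}` if `(p,q) = (p',q')` and
`0` otherwise (`α^{p,q}` has type `(p,q)` by `isOfType_typeComponent_holds`, then
`IsOfType.typeComponent_eq_self` / `IsOfType.typeComponent_of_ne_holds`; off the antidiagonal
`α^{p,q} = 0`). Voisin (2002), §2.3.1, eq. (2.4), p. 53; Wells (1980), Ch. I §3. [cite: Voisin2002, §2.3.1 eq. (2.4)] -/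
theorem typeComponent_typeComponent_holds :
    typeComponent_typeComponent (E := E) (M := M) (k := k) := by
  intro p q p' q' α
  by_cases hk : p + q = k
  · have ht := isOfType_typeComponent_holds hk α
    split_ifs with h
    · obtain ⟨rfl, rfl⟩ := h
      exact ht.typeComponent_eq_self
    · exact IsOfType.typeComponent_of_ne_holds ht (by tauto)
  · rw [Literature.Geometry.Kaehler.MForm.typeComponent_of_ne hk, Literature.Geometry.Kaehler.MForm.typeComponent_zero]
    split_ifs <;> rfl

/-- Discharge of the named fact `Literature.NumberTheory.Transcendental.typeComponent_typeComponent_self`: **the type projection is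
idempotent**, `(α^{p,q})^{p,q} = α^{p,q}` (the diagonal case of
`typeComponent_typeComponent_holds`). Voisin (2002), §2.3.1, eq. (2.4), p. 53. [cite: Voisin2002, §2.3.1 eq. (2.4)] -/
theorem typeComponent_typeComponent_self_holds :
    typeComponent_typeComponent_self (E := E) (M := M) (k := k) := by
  intro p q α
  have h := typeComponent_typeComponent_holds p q p q α
  rwa [if_pos ⟨rfl, rfl⟩] at h

/-- Discharge of the named fact `Literature.NumberTheory.Transcendental.sum_antidiagonal_typeComponent`: **type decomposition of a
complex `k`-form**, `α = ∑_{p+q=k} α^{p,q}`, i.e. `Λ^k Ω_{X,ℂ} = ⊕_{p+q=k} Ω_X^{p,q}` pointwise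
(Voisin (2002), §2.3.1, eq. (2.4), p. 53). Proof: write `α(x)(e^{iθ}v) = ∑_m c_m e^{imθ}` with
frequencies `m = p - q`, `p + q = k` (`MForm.exists_fourier`); then `α^{p,q}(x)(v) = c_{p-q}`
(`MForm.weightComponent_apply_eq_coeff`) and `α(x)(v) = ∑_m c_m` (`θ = 0`), the map
`(p,q) ↦ p - q` being a bijection from the antidiagonal onto the admissible frequencies
(`exists_antidiagonal_sub_eq_of_natAbs_le`). [cite: Voisin2002, §2.3.1 eq. (2.4)] -/
theorem sum_antidiagonal_typeComponent_holds :
    sum_antidiagonal_typeComponent (E := E) (M := M) (k := k) := by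
  intro α
  funext x; ext v
  obtain ⟨P, hP, hPev⟩ := α.exists_fourier x v
  rw [Finset.sum_apply, ContinuousAlternatingMap.sum_apply]
  have hterm : ∀ pq ∈ antidiagonal k,
      (α.typeComponent pq.1 pq.2) x v = P.coeff ((pq.1 : ℤ) - pq.2) := by
    intro pq hpq
    rw [Finset.mem_antidiagonal] at hpq
    rw [Literature.Geometry.Kaehler.MForm.typeComponent, if_pos hpq]
    exact α.weightComponent_apply_eq_coeff x v hP hPev (by omega)
  rw [Finset.sum_congr rfl hterm]
  have hα : α x v = ∑ m ∈ P.coeff.support, P.coeff m := by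
    have := hPev 0
    rw [tangentRotate_zero_comp] at this
    rw [this]
    refine Finset.sum_congr rfl fun m _ ↦ ?_
    push_cast
    simp only [mul_zero, zero_mul, Complex.exp_zero, mul_one]
  rw [hα]
  have hinj : Set.InjOn (fun pq : ℕ × ℕ ↦ (pq.1 : ℤ) - pq.2) (antidiagonal k : Set (ℕ × ℕ)) := by
    rintro ⟨a, b⟩ hab ⟨c, d⟩ hcd h
    rw [Finset.mem_coe, Finset.mem_antidiagonal] at hab hcd
    simp only at h hab hcd
    have h1 : a = c := by omega
    have h2 : b = d := by omega
    rw [h1, h2]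
  rw [← Finset.sum_image (g := fun pq : ℕ × ℕ ↦ (pq.1 : ℤ) - pq.2) (f := fun m ↦ P.coeff m) hinj]
  symm
  refine Finset.sum_subset (fun m hm ↦ ?_) (fun m _ hm ↦ Finsupp.notMem_support_iff.mp hm)
  obtain ⟨pq, hpq, rfl⟩ := exists_antidiagonal_sub_eq_of_natAbs_le (hP m hm)
  exact Finset.mem_image_of_mem _ hpq

/-! ### Conjugation and wedge product -/

section ConjWedge

variable {l : ℕ}

/-- **Conjugation and weight components**: `(ᾱ)_w = \overline{α_{-w}}` — complex conjugation
commutes with the finite Fourier average defining `Literature.Geometry.Kaehler.MForm.weightComponent` and conjugates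
the characters, `\overline{e^{-i(-w)θ_j}} = e^{-iwθ_j}`. [folklore] -/
theorem _root_.Literature.Geometry.Kaehler.MForm.conj_weightComponent_neg (α : Literature.Geometry.Kaehler.MForm 𝓘(ℝ, E) M ℂ k) (w : ℤ) :
    α.conj.weightComponent w = (α.weightComponent (-w)).conj := by
  funext x; ext v
  simp only [Literature.Geometry.Kaehler.MForm.weightComponent, Literature.Geometry.Kaehler.MForm.conj_apply, ContinuousAlternatingMap.smul_apply,
    ContinuousAlternatingMap.sum_apply, ContinuousAlternatingMap.compContinuousLinearMap_apply,
    smul_eq_mul, map_mul, map_sum, map_inv₀, map_natCast]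
  congr 1
  refine Finset.sum_congr rfl fun j _ ↦ ?_
  congr 1
  rw [← Complex.exp_conj]
  congr 1
  simp only [map_mul, map_neg, Complex.conj_ofReal, Complex.conj_I]
  push_cast
  ring

/-- Discharge of the named fact `Literature.NumberTheory.Transcendental.typeComponent_conj` (vendored with `[cite pending]`):
**Hodge symmetry of the type projections**, `(ᾱ)^{p,q} = \overline{α^{q,p}}`, i.e.
`\overline{Ω_X^{p,q}} = Ω_X^{q,p}` for the projections of `ComplexForms.lean`
(`MForm.conj_weightComponent_neg` with `-(p - q) = q - p`; off the antidiagonal both sides are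
`0`). Voisin (2002), Introduction, the display `\overline{Ω_X^{p,q}} = Ω_X^{q,p}` after
eq. (0.2); Wells (1980), Ch. I §3. [cite: Voisin2002, Introduction, Hodge symmetry after eq. (0.2)] -/
theorem typeComponent_conj_holds : typeComponent_conj (E := E) (M := M) (k := k) := by
  intro p q α
  unfold Literature.Geometry.Kaehler.MForm.typeComponent
  by_cases h : p + q = k
  · rw [if_pos h, if_pos (by omega), Literature.Geometry.Kaehler.MForm.conj_weightComponent_neg]
    congr 2
    ring
  · rw [if_neg h, if_neg (by omega)]
    funext x; ext v
    simp

omit [NormedSpace ℂ E] in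
/-- **Scaling of a wedge product under a linear map acting by scalars**: if `a ∘ R = c_a · a` and
`b ∘ R = c_b · b` for complex-valued real-alternating maps `a`, `b` and a real-linear `R`, then
`(a ∧ b) ∘ R = c_a c_b · (a ∧ b)` (read off the shuffle formula
`ContinuousAlternatingMap.wedge_apply` of `FormsAlgebra.lean`). Deliberate extension of the
Mathlib namespace `ContinuousAlternatingMap`, like `ContinuousAlternatingMap.wedge` itself. [folklore] -/
theorem ContinuousAlternatingMap.wedge_apply_comp_eq_mul {E : Type*} [NormedAddCommGroup E]
    [NormedSpace ℝ E] (a : E [⋀^Fin k]→L[ℝ] ℂ) (b : E [⋀^Fin l]→L[ℝ] ℂ) (R : E →L[ℝ] E)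
    (ca cb : ℂ) (ha : ∀ u : Fin k → E, a (fun i ↦ R (u i)) = ca * a u)
    (hb : ∀ u : Fin l → E, b (fun i ↦ R (u i)) = cb * b u) (v : Fin (k + l) → E) :
    (a.wedge b) (fun i ↦ R (v i)) = ca * cb * (a.wedge b) v := by
  simp only [ContinuousAlternatingMap.wedge_apply, ha, hb]
  rw [mul_smul_comm, Finset.mul_sum]
  congr 1
  refine Finset.sum_congr rfl fun σ _ ↦ ?_
  rw [mul_smul_comm]
  congr 1
  ring

/-- Discharge of the named fact `Literature.NumberTheory.Transcendental.IsOfType.wedge`: **types add under the wedge product**,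
`A^{p,q} ∧ A^{p',q'} ⊆ A^{p+p',q+q'}` — the rotation `e^{iθ}` acts on `α(x)` by `e^{i(p-q)θ}`
and on `β(x)` by `e^{i(p'-q')θ}`, hence on `α(x) ∧ β(x)` by `e^{i(p+p'-q-q')θ}`
(`ContinuousAlternatingMap.wedge_apply_comp_eq_mul`). Voisin (2002), §2.3.1, eq. (2.4) with
`Ω_X^{p,q} = Λ^p Ω_X^{1,0} ⊗ Λ^q Ω_X^{0,1}` (p. 53); Huybrechts (2005), §1.3. [cite: Voisin2002, §2.3.1 eq. (2.4)] -/
theorem IsOfType.wedge_holds : IsOfType.wedge (E := E) (M := M) (k := k) (l := l) := by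
  intro p q p' q' α β hα hβ
  refine ⟨by have := hα.1; have := hβ.1; omega, fun x θ v ↦ ?_⟩
  have h := ContinuousAlternatingMap.wedge_apply_comp_eq_mul
    (show E [⋀^Fin k]→L[ℝ] ℂ from α x) (show E [⋀^Fin l]→L[ℝ] ℂ from β x)
    (tangentRotate E x θ) _ _ (fun u ↦ hα.2 x θ u) (fun u ↦ hβ.2 x θ u) v
  refine h.trans ?_
  rw [← Complex.exp_add]
  congr 2
  push_cast
  ring

end ConjWedge

/-! ### The exterior derivative commutes with complex scalars and with conjugation -/

section Derivative

omit [NormedSpace ℂ E] in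
/-- `extDerivWithin` commutes with complex scalars on complex-valued real forms, at every point
of unique differentiability (no differentiability of the form is needed: for `c ≠ 0` the scalar
is invertible, `fderivWithin_const_smul_field`, and `alternatizeUncurryFin` is linear over the
scalars acting on the codomain). (The form is called `φ`: `ω` is notation in scope `ContDiff`.) [folklore] -/
theorem extDerivWithin_smul_complex {E : Type*} [NormedAddCommGroup E] [NormedSpace ℝ E]
    (c : ℂ) (φ : E → E [⋀^Fin k]→L[ℝ] ℂ) {s : Set E} {y : E} (hs : UniqueDiffWithinAt ℝ s y) :
    extDerivWithin (c • φ) s y = c • extDerivWithin φ s y := by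
  have h := fderivWithin_const_smul_field (𝕜 := ℝ) (f := φ) c hs
  rw [extDerivWithin, extDerivWithin]
  rw [h]
  exact ContinuousAlternatingMap.alternatizeUncurryFin_smul c _

/-- Discharge of the named fact `Literature.NumberTheory.Transcendental.mextDeriv_smul_complex`: **the exterior derivative of
complex forms is `ℂ`-linear**, `d(cα) = c dα` for every complex `k`-form `α` and `c ∈ ℂ` (no
smoothness needed: `range 𝓘(ℝ, E)` has unique derivatives; `extDerivWithin_smul_complex` in each
chart). This is the `ℂ`-linear extension of the real operator `d` to
`Ω^k_{X,ℂ} = Ω^k_{X,ℝ} ⊗ ℂ` (Voisin (2002), Introduction, eq. (0.2); Wells (1980), Ch. II §1). [folklore] -/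
theorem mextDeriv_smul_complex_holds : mextDeriv_smul_complex (E := E) (M := M) (k := k) := by
  intro c α
  funext x
  have hU : UniqueDiffWithinAt ℝ (range 𝓘(ℝ, E)) (extChartAt 𝓘(ℝ, E) x x) :=
    (𝓘(ℝ, E)).uniqueDiffOn _ (extChartAt_target_subset_range x (mem_extChartAt_target x))
  simp only [Literature.Geometry.Kaehler.mextDeriv, Literature.Geometry.Kaehler.MForm.inChart_smul_complex]
  rw [extDerivWithin_smul_complex c _ hU]
  rfl

omit [NormedSpace ℂ E] in
/-- `extDerivWithin` commutes with post-composition by complex conjugation on complex-valued real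
forms, at every point of unique differentiability (no differentiability of the form is needed:
post-composition with the real-linear automorphism `conj` of `ℂ` is a continuous linear
equivalence of the space of forms, `ContinuousLinearEquiv.comp_fderivWithin`, and
`alternatizeUncurryFin` is natural in the codomain). [folklore] -/
theorem extDerivWithin_conj {E : Type*} [NormedAddCommGroup E] [NormedSpace ℝ E]
    (φ : E → E [⋀^Fin k]→L[ℝ] ℂ) {s : Set E} {y : E} (hs : UniqueDiffWithinAt ℝ s y) :
    extDerivWithin
        (fun z ↦ (Complex.conjCLE : ℂ →L[ℝ] ℂ).compContinuousAlternatingMap (φ z)) s y =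
      (Complex.conjCLE : ℂ →L[ℝ] ℂ).compContinuousAlternatingMap (extDerivWithin φ s y) := by
  set iso : (E [⋀^Fin k]→L[ℝ] ℂ) ≃L[ℝ] (E [⋀^Fin k]→L[ℝ] ℂ) :=
    (Complex.conjCLE : ℂ ≃L[ℝ] ℂ).continuousAlternatingMapCongrRight with hiso
  have hcomp : (fun z ↦ (Complex.conjCLE : ℂ →L[ℝ] ℂ).compContinuousAlternatingMap (φ z)) =
      iso ∘ φ := by
    funext z; rfl
  rw [hcomp, extDerivWithin, extDerivWithin, iso.comp_fderivWithin hs]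
  ext v
  simp only [ContinuousAlternatingMap.alternatizeUncurryFin_apply,
    ContinuousLinearMap.compContinuousAlternatingMap_coe, Function.comp_apply,
    ContinuousLinearMap.coe_comp, map_sum, map_zsmul]
  rfl

/-- Discharge of the named fact `Literature.NumberTheory.Transcendental.mextDeriv_conj`: **the exterior derivative commutes with
conjugation**, `d ᾱ = \overline{dα}` for every complex `k`-form `α` (no smoothness needed;
`extDerivWithin_conj` in each chart, the chart representative of `ᾱ` being the conjugate of
that of `α`, `MForm.inChart_conj`). `d` is a real operator: this is the relation behind
`∂α = \overline{∂̄ ᾱ}` in Voisin (2002), §2.3.1, proof of Lemma 2.28 (p. 54); Wells (1980),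
Ch. I §3. [cite: Voisin2002, §2.3.1, proof of Lemma 2.28] -/
theorem mextDeriv_conj_holds : mextDeriv_conj (E := E) (M := M) (k := k) := by
  intro α
  funext x
  have hU : UniqueDiffWithinAt ℝ (range 𝓘(ℝ, E)) (extChartAt 𝓘(ℝ, E) x x) :=
    (𝓘(ℝ, E)).uniqueDiffOn _ (extChartAt_target_subset_range x (mem_extChartAt_target x))
  change (extDerivWithin (α.conj.inChart x) (range 𝓘(ℝ, E))
    (extChartAt 𝓘(ℝ, E) x x)).compContinuousLinearMap _ = _
  rw [Literature.Geometry.Kaehler.MForm.inChart_conj, extDerivWithin_conj _ hU]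
  rfl

end Derivative

/-! ### Appended (v2): conjugation preserves closed and exact smooth complex forms

Discharge of the two named facts `conj_mem_cclosedSmoothForms` and `conj_mem_cexactSmoothForms` of
`ComplexForms.lean` (Wells (1980), Ch. II §1) from `mextDeriv_conj_holds` (`d ᾱ = \overline{dα}`)
and `isSmoothForm_conj`: conjugation maps the generators of the `ℂ`-spans `Z^k(M; ℂ)` (smooth
closed forms) and `B^{k+1}(M; ℂ)` (`d` of smooth `k`-forms) into themselves, and is additive and
conjugate-linear, so it preserves the spans. Consumers: the Hodge symmetry of
`Literature/AlgebraicGeometry/Motives/HodgeDecomposition` and the reduction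
`Literature.AlgebraicGeometry.HodgeTheory.Voisin2003_hypersurface_hodgePQ_zero_ne_bot_of`. -/

section ConjSpan

/-- The conjugate of the zero form is zero. [folklore] -/
theorem _root_.Literature.Geometry.Kaehler.MForm.conj_zero :
    (0 : Literature.Geometry.Kaehler.MForm 𝓘(ℝ, E) M ℂ k).conj = 0 := by
  funext x; ext v; simp

/-- Discharge of the named fact `Literature.NumberTheory.Transcendental.conj_mem_cclosedSmoothForms`:
**conjugation preserves closed smooth complex forms** — for a smooth closed `β`, `β̄` is smooth
(`isSmoothForm_conj`) and `dβ̄ = \overline{dβ} = 0` (`mextDeriv_conj_holds`); then induct over the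
`ℂ`-span (`\overline{β + γ} = β̄ + γ̄`, `\overline{cβ} = c̄ β̄`). Wells (1980), Ch. II §1.
[cite: WellsDACM1980, Ch. II §1] -/
theorem conj_mem_cclosedSmoothForms_holds : conj_mem_cclosedSmoothForms (E := E) (M := M) (k := k) := by
  intro α hα
  induction hα using Submodule.span_induction with
  | mem β hβ =>
    refine Submodule.subset_span ⟨isSmoothForm_conj hβ.1, ?_⟩
    change Literature.Geometry.Kaehler.mextDeriv β.conj = 0
    have h0 : Literature.Geometry.Kaehler.mextDeriv β = 0 := hβ.2
    rw [mextDeriv_conj_holds β, h0, Literature.Geometry.Kaehler.MForm.conj_zero]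
  | zero => rw [Literature.Geometry.Kaehler.MForm.conj_zero]; exact Submodule.zero_mem _
  | add β γ _ _ hβ hγ => rw [Literature.Geometry.Kaehler.MForm.conj_add]; exact add_mem hβ hγ
  | smul c β _ hβ => rw [Literature.Geometry.Kaehler.MForm.conj_smul]; exact Submodule.smul_mem _ _ hβ

/-- Discharge of the named fact `Literature.NumberTheory.Transcendental.conj_mem_cexactSmoothForms`:
**conjugation preserves exact smooth complex forms** — `\overline{dγ} = d γ̄` with `γ̄` smooth
(`mextDeriv_conj_holds`, `isSmoothForm_conj`), then induct over the `ℂ`-span; degree `0` is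
`B⁰ = 0`. Wells (1980), Ch. II §1. [cite: WellsDACM1980, Ch. II §1] -/
theorem conj_mem_cexactSmoothForms_holds : conj_mem_cexactSmoothForms (E := E) (M := M) (k := k) := by
  intro α hα
  cases k with
  | zero =>
    have h : α = 0 := by simpa [cexactSmoothForms] using hα
    rw [h, Literature.Geometry.Kaehler.MForm.conj_zero]
    exact Submodule.zero_mem _
  | succ k =>
    change α ∈ Submodule.span ℂ _ at hα
    change α.conj ∈ Submodule.span ℂ _
    induction hα using Submodule.span_induction with
    | mem β hβ =>
      obtain ⟨γ, hγ, rfl⟩ := hβ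
      refine Submodule.subset_span ⟨γ.conj, ?_, mextDeriv_conj_holds γ⟩
      exact (mem_csmoothForms_iff _).2 (isSmoothForm_conj ((mem_csmoothForms_iff γ).1 hγ))
    | zero => rw [Literature.Geometry.Kaehler.MForm.conj_zero]; exact Submodule.zero_mem _
    | add β γ _ _ hβ hγ => rw [Literature.Geometry.Kaehler.MForm.conj_add]; exact add_mem hβ hγ
    | smul c β _ hβ => rw [Literature.Geometry.Kaehler.MForm.conj_smul]; exact Submodule.smul_mem _ _ hβ

end ConjSpan

/-! ### Appended (v3): the `ℂ`-spans add nothing — `Z^k(M; ℂ)`, `B^k(M; ℂ)` as real modules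

Discharge of the two named facts `restrictScalars_cclosedSmoothForms` and
`restrictScalars_cexactSmoothForms` of `ComplexForms.lean` (Wells (1980), Ch. II §1): the
underlying `ℝ`-modules of the `ℂ`-spans `cclosedSmoothForms E M k`, `cexactSmoothForms E M k` are
G21's `closedSmoothForms 𝓘(ℝ, E) M ℂ k`, `exactSmoothForms 𝓘(ℝ, E) M ℂ k`, because `d` is
`ℂ`-linear on complex forms (`mextDeriv_smul_complex_holds`) and additive on smooth forms, so that
the generating sets are already `ℂ`-stable up to the span operations. Consumers: the real
structure of complex de Rham cohomology (`Transcendental/ComplexDeRhamRealStructure`: real and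
imaginary parts of complex de Rham classes). -/

section RestrictScalars

/-- **Membership in `Z^k(M; ℂ)` is "smooth and closed"**: the `ℂ`-span in the definition of
`cclosedSmoothForms` adds nothing (`d(cα) = c dα`, `mextDeriv_smul_complex_holds`).
[cite: WellsDACM1980, Ch. II §1] -/
theorem mem_cclosedSmoothForms_iff (α : Literature.Geometry.Kaehler.MForm 𝓘(ℝ, E) M ℂ k) :
    α ∈ cclosedSmoothForms E M k ↔
      Literature.Geometry.Kaehler.IsSmoothForm α ∧ Literature.Geometry.Kaehler.IsClosedForm α := by
  refine ⟨fun hα ↦ ?_, fun hα ↦ Submodule.subset_span hα⟩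
  induction hα using Submodule.span_induction with
  | mem β hβ => exact hβ
  | zero => exact (Literature.Geometry.Kaehler.closedSmoothForms 𝓘(ℝ, E) M ℂ k).zero_mem
  | add β γ _ _ hβ hγ =>
    exact (Literature.Geometry.Kaehler.closedSmoothForms 𝓘(ℝ, E) M ℂ k).add_mem hβ hγ
  | smul c β _ hβ =>
    refine ⟨hβ.1.smul_complex c, ?_⟩
    have h0 : Literature.Geometry.Kaehler.mextDeriv β = 0 := hβ.2
    change Literature.Geometry.Kaehler.mextDeriv (c • β) = 0
    rw [mextDeriv_smul_complex_holds c β, h0, smul_zero]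

/-- Discharge of the named fact
`Literature.NumberTheory.Transcendental.restrictScalars_cclosedSmoothForms`: **the underlying
`ℝ`-module of `Z^k(M; ℂ)` is G21's `closedSmoothForms 𝓘(ℝ, E) M ℂ k`**
(`mem_cclosedSmoothForms_iff`). Wells (1980), Ch. II §1. [cite: WellsDACM1980, Ch. II §1] -/
theorem restrictScalars_cclosedSmoothForms_holds :
    restrictScalars_cclosedSmoothForms (E := E) (M := M) := by
  intro k
  ext α
  rw [Submodule.restrictScalars_mem, mem_cclosedSmoothForms_iff]
  rfl

/-- **An exact smooth complex form of positive degree is `dβ` for a smooth complex form `β`**, and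
conversely: the `ℂ`-span in the definition of `cexactSmoothForms E M (k + 1)` adds nothing, `d`
being additive on smooth forms and `ℂ`-linear (`mextDeriv_smul_complex_holds`).
[cite: WellsDACM1980, Ch. II §1] -/
theorem mem_cexactSmoothForms_succ_iff (α : Literature.Geometry.Kaehler.MForm 𝓘(ℝ, E) M ℂ (k + 1)) :
    α ∈ cexactSmoothForms E M (k + 1) ↔ ∃ β : Literature.Geometry.Kaehler.MForm 𝓘(ℝ, E) M ℂ k,
      Literature.Geometry.Kaehler.IsSmoothForm β ∧ α = Literature.Geometry.Kaehler.mextDeriv β := by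
  constructor
  · intro hα
    change α ∈ Submodule.span ℂ _ at hα
    induction hα using Submodule.span_induction with
    | mem x hx =>
      obtain ⟨β, hβ, rfl⟩ := hx
      exact ⟨β, (mem_csmoothForms_iff β).1 hβ, rfl⟩
    | zero =>
      exact ⟨0, Literature.Geometry.Kaehler.isSmoothForm_zero,
        Literature.Geometry.Kaehler.mextDeriv_zero.symm⟩
    | add x y _ _ hx hy =>
      obtain ⟨β, hβ, rfl⟩ := hx
      obtain ⟨γ, hγ, rfl⟩ := hy
      exact ⟨β + γ, hβ.add hγ, (Literature.Geometry.Kaehler.mextDeriv_add hβ hγ).symm⟩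
    | smul c x _ hx =>
      obtain ⟨β, hβ, rfl⟩ := hx
      exact ⟨c • β, hβ.smul_complex c, (mextDeriv_smul_complex_holds c β).symm⟩
  · rintro ⟨β, hβ, rfl⟩
    exact Submodule.subset_span ⟨β, (mem_csmoothForms_iff β).2 hβ, rfl⟩

/-- Discharge of the named fact
`Literature.NumberTheory.Transcendental.restrictScalars_cexactSmoothForms`: **the underlying
`ℝ`-module of `B^k(M; ℂ)` is G21's `exactSmoothForms 𝓘(ℝ, E) M ℂ k`** — both are `0` in
degree `0`; in degree `k + 1` an element of the `ℂ`-span is a single `dβ`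
(`mem_cexactSmoothForms_succ_iff`), which lies in the `ℝ`-span, and the `ℝ`-span of a set is
contained in its `ℂ`-span (`Submodule.span_le_restrictScalars`). Wells (1980), Ch. II §1.
[cite: WellsDACM1980, Ch. II §1] -/
theorem restrictScalars_cexactSmoothForms_holds :
    restrictScalars_cexactSmoothForms (E := E) (M := M) := by
  intro k
  cases k with
  | zero =>
    ext α
    simp [cexactSmoothForms, Literature.Geometry.Kaehler.exactSmoothForms]
  | succ k =>
    refine le_antisymm (fun α hα ↦ ?_) ?_
    · rw [Submodule.restrictScalars_mem, mem_cexactSmoothForms_succ_iff] at hα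
      obtain ⟨β, hβ, rfl⟩ := hα
      exact Submodule.subset_span ⟨β, hβ, rfl⟩
    · have hs : (Literature.Geometry.Kaehler.mextDeriv ''
          (Literature.Geometry.Kaehler.smoothForms 𝓘(ℝ, E) M ℂ k :
            Set (Literature.Geometry.Kaehler.MForm 𝓘(ℝ, E) M ℂ k))) =
          Literature.Geometry.Kaehler.mextDeriv ''
            (csmoothForms E M k : Set (Literature.Geometry.Kaehler.MForm 𝓘(ℝ, E) M ℂ k)) := by
        congr 1
        ext β
        exact (mem_csmoothForms_iff β).symm
      change Submodule.span ℝ _ ≤ (Submodule.span ℂ _).restrictScalars ℝ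
      rw [hs]
      exact Submodule.span_le_restrictScalars ℝ ℂ _

/-- With both facts discharged: **two closed smooth complex forms define the same complex de Rham
class iff their difference is `ℝ`-exact** (i.e. lies in G21's `exactSmoothForms 𝓘(ℝ, E) M ℂ k`).
[cite: WellsDACM1980, Ch. II §1] -/
theorem complexDeRhamCohomology.mk_eq_mk_iff_mem_exactSmoothForms (α β : cclosedSmoothForms E M k) :
    complexDeRhamCohomology.mk E M k α = complexDeRhamCohomology.mk E M k β ↔
      (α : Literature.Geometry.Kaehler.MForm 𝓘(ℝ, E) M ℂ k) - β ∈
        Literature.Geometry.Kaehler.exactSmoothForms 𝓘(ℝ, E) M ℂ k := by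
  rw [complexDeRhamCohomology.mk_eq_mk_iff, ← restrictScalars_cexactSmoothForms_holds k,
    Submodule.restrictScalars_mem]

end RestrictScalars

end Literature.NumberTheory.Transcendental
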